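/-
Origin: expansion seat `planner-pub-hodgecm-pv13-g6-0`, handover #1b 2026-08-18T15:16Z (md5 44b6b641e7720ee85f4139c71341a158, 306 l., 12 decls; part II; ONE import rewrite `import Pv13g6.GenuineSchrodingerHeisTranslate` ↦ `import HodgeCM.PerL34.GenuineSchrodingerHeisTranslate`; land AFTER #1a) (`HOME/pub-hodgecm-pv13-g6/lean/Pv13g6/GenuineSchrodingerHeisModulate.lean`, md5 44b6b641, 306 lines);
landed by the gen-8 packager in gate run 31 as `HodgeCM/PerL34/GenuineSchrodingerHeisModulate.lean` (import ^import Pv13g6\.GenuineSchrodingerHeisTranslate[ \t]*$→import HodgeCM.PerL34.GenuineSchrodingerHeisTranslate ×1).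
-/
/-
Copyright (c) 2026. All rights reserved.
Released under Apache 2.0 license as described in the file LICENSE.
Authors: unit pub-hodgecm-pv13-g6 (DAG-NODE PROVER #13 gen 6, seam S3, 𝓕-side).

# HodgeCM/PerL34/GenuineSchrodingerHeisModulate.lean — scaled boxes, uniform unramifiedness, MODULATION stabilisers
# of `𝒮(X)`, and the smooth vectors `L²(X)^∞ ⊇ 𝒮(X)` of the adelic Heisenberg–Schrödinger representation  (part II of three)
-/
import Summits.HodgeConjecture.HodgeCM.PerL34.GenuineSchrodingerHeisTranslate

/-!
# The Schwartz–Bruhat space `𝒮(X)` through the adelic Heisenberg group, II: modulations and smooth vectors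

`X = Space L = Πʳ_{v split} [(L⁺_v)³, 𝒪_v³]` is the genuine global split Schrödinger space of the
package (`GenuineSchrodingerModel`), `L²(X) = Lp ℂ 2 (μ L)`, `𝒮(X) = Coeff.schwartzBruhat L` the span
of the indicators `1_A` of compact open `A ⊆ X` (pv07-g5 `GenuineSchrodingerSchwartz`; = the locally
constant compactly supported classes, pv13-g5 `GenuineSchrodingerSchwartzDense`), `B_k = levelBall L k`
the compact open level subgroups (pv13-g5 `GenuineSchrodingerRigid`), `τ_y = translate (μ L) y` and
`M_ξ = modulate (μ L) (heisCharA ψ hψc hψO ξ)` the translations and the adelic Heisenberg modulations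
`u ↦ ψ_𝔸(⟨ξ, u⟩) f(u)` (pv13-g5 `GenuineSchrodingerHeisenberg`), for character DATA
`ψ = (ψ_v)_v`, `ψ_v : L⁺_v → U(1)` continuous additive characters with `ψ_v(𝒪_v) = 1` at almost
all `v` (`hψO`).  PROVED HERE, in the kernel and with no further input:

* §4b scaled boxes `k • ∏_v 𝒪_v³` (`k ∈ U(1)(𝔸_{L⁺})`, acting through the base charts) are compact, idèles of
  prescribed size exist (`exists_model_norm_unitAt`), so every box with finitely many radii `≠ 1` is compact
  (`isCompact_setOf_forall_norm_le`).
* §5 `exists_level_heisPairing_eq_one_on`: on a compact set the characters `ψ_𝔸(⟨ξ, ·⟩)`, `ξ ∈ B_k`, are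
  `≡ 1` for `k` large (uniform unramifiedness `exists_level_heisPairing_box_eq_one` + bi-additivity);
  hence `exists_level_modulate_eq`: every `f ∈ 𝒮(X)` is FIXED by `M(B_k)` for some `k`.
* §6 the SMOOTH VECTORS `heisSmooth ψ hψc hψO = {f : ∃ k, τ(B_k) f = f ∧ M(B_k) f = f}` (a submodule)
  and `schwartzBruhat_le_heisSmooth : 𝒮(X) ⊆ L²(X)^∞`; `mem_schwartzBruhat_iff_heisSmooth`:
  `𝒮(X) = L²(X)^∞ ∩ {compactly supported}`.

Part I (`GenuineSchrodingerHeisTranslate`) supplies the translation stabilisers (§1), the converse (§2) and the strong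
continuity of the translations (§4) used here.

TREE SHAPE (LEAN-IN-TREE RULE 2026-08-18, `lean/CONVENTIONS.md`: ≤ 400 lines per file).  The material of
this seat's RUN-31 row 1 (891 lines as first handed, md5 a777f951…) is staged as THREE files with byte-identical
declarations: `GenuineSchrodingerHeisTranslate` (§§1–4) → `GenuineSchrodingerHeisModulate` (§§4b–6) →
`GenuineSchrodingerHeisSmooth` (§§7–9; that module name is kept, so `GenuineSchrodingerHeisAdmissible` /
`GenuineSchrodingerHeisFixedDim` import it unchanged).

ABSOLUTE RULE.  Nothing is cited and nothing is posited: every statement is kernel-proved here from the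
package's earlier kernel nodes (RUN-28 `LocalFactors.SchrodingerIrreducible`, `SchrodingerLevi`; RUN-30
pv07-g5 `GenuineSchrodingerSchwartz`, pv13-g5 `GenuineSchrodingerRigid` / `…Heisenberg` / `…SchwartzDense`)
and Mathlib; the only hypotheses are DATA supplied by the caller (the local characters `ψ`, `hψc`, `hψO`).
No PerL / QW8 / 2001-programme statement appears.

Orientation in print (not used as input): the smooth vectors of the Schrödinger representation of a
Heisenberg group over a local field / the adèles form the Schwartz–Bruhat space — A. Weil, *Sur certains
groupes d'opérateurs unitaires*, Acta Math. 111 (1964), Ch. I; C. Mœglin, M.-F. Vignéras,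
J.-L. Waldspurger, *Correspondances de Howe sur un corps p-adique*, LNM 1291 (1987), ch. 2, I;
F. Bruhat, *Distributions sur un groupe localement compact et applications à l'étude des représentations
des groupes p-adiques*, Bull. SMF 89 (1961); restricted products and characters of order `0` at almost
all places: J. Tate, *Fourier analysis in number fields and Hecke's zeta-functions*, in Cassels–Fröhlich,
Algebraic Number Theory (1967).

Namespace `HodgeCM.PerL34.PureTensor.SchrodingerModel.Coeff`; the `ψ`-dependent part is the section
`Characters` with the variables `ψ hψc hψO` of pv13-g5 `GenuineSchrodingerHeisenberg` §2 (same binder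
shapes, `hψO` included).
-/

set_option autoImplicit false

noncomputable section

open MeasureTheory MeasureTheory.Measure Set Metric Function Complex Topology Filter
open scoped RestrictedProduct InnerProductSpace NNReal ENNReal Pointwise

namespace HodgeCM.PerL34.PureTensor.SchrodingerModel

open HodgeCM.PerL34.LocalFactors HodgeCM.PerL34.LocalFactors.DilationModel
open HodgeCM.PerL34.LocalFactors.SchrodingerLevi HodgeCM.PerL34.LocalFactors.SchrodingerIrreducible
open HodgeCM.PerL34.IdelePlaces HodgeCM.PerL34.IdelicTorusModel HodgeCM.PerL34.IdelicTorusModel.Genuine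
open NumberField IsDedekindDomain

attribute [local instance] LocalFactors.DilationModel.Adic.nontriviallyNormedField
  LocalFactors.DilationModel.Adic.properSpace

variable {L : Type} [Field L] [NumberField L] [IsCMField L]

namespace Coeff

/-! ## §4b  Scaled boxes `k • ∏_v 𝒪_v³`, `k ∈ U(1)(𝔸_{L⁺})`, are compact; idèles of prescribed size -/

/-- the scaled box `k • ∏_v 𝒪_v³` is compact -/
theorem isCompact_smul_box (k : Model L) : IsCompact (k • (box L : Set (Space L))) :=
  (box L).isCompact.image (continuous_const_smul k)

/-- the box of radii `‖k_v‖` lies in the scaled box `k • ∏_v 𝒪_v³` -/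
theorem setOf_norm_le_subset_smul_box (k : Model L) :
    {u : Space L | ∀ i, ‖u i‖ ≤ ‖(unitAt k i).val‖} ⊆ k • (box L : Set (Space L)) := by
  intro u hu
  rw [Set.mem_smul_set_iff_inv_smul_mem, mem_box_iff]
  intro i
  have hpos : 0 < ‖(unitAt k i).val‖ := norm_pos_iff.2 (unitAt k i).ne_zero
  rw [mem_cube_iff, smul_apply, norm_smul, unitAt_inv, Units.val_inv_eq_inv_val, norm_inv,
    inv_mul_le_iff₀ hpos, mul_one]
  exact hu i

/-- **idèles of prescribed size**: for a finite set `S` of split places and radii `R`, some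
`k ∈ U(1)(𝔸_{L⁺})` has `‖k_v‖ ≥ R_v` for `v ∈ S` and `‖k_v‖ = 1` for `v ∉ S` (split components read
through the base charts `baseTriv`). -/
theorem exists_model_norm_unitAt (S : Finset (SplitIdx L)) (R : SplitIdx L → ℝ) :
    ∃ k : Model L, (∀ i ∈ S, R i ≤ ‖(unitAt k i).val‖) ∧ ∀ i ∉ S, ‖(unitAt k i).val‖ = 1 := by
  classical
  induction S using Finset.induction_on with
  | empty =>
    exact ⟨1, fun i hi => absurd hi (Finset.notMem_empty i), fun i _ => by
      rw [unitAt_one, Units.val_one, norm_one]⟩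
  | insert a S haS ih =>
    obtain ⟨k, hkS, hkS'⟩ := ih
    obtain ⟨x, hx⟩ :=
      NormedField.exists_lt_norm ((basePlaceOf L a.1).adicCompletion (maximalRealSubfield L)) (max (R a) 1)
    have hx0 : x ≠ 0 := fun h => by
      rw [h, norm_zero] at hx
      exact lt_irrefl (0 : ℝ) ((lt_max_of_lt_right one_pos).trans hx)
    set g := (baseTriv L a.1 a.2).symm (Units.mk0 x hx0) with hg
    have hga : (unitAt (RestrictedProduct.mulSingle (genLevel L) a.1 g) a).val = x := by
      rw [unitAt_mulSingle_self, hg, ContinuousMulEquiv.apply_symm_apply, Units.val_mk0]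
    have hgne : ∀ i : SplitIdx L, i ≠ a → (unitAt (RestrictedProduct.mulSingle (genLevel L) a.1 g) i).val = 1 :=
      fun i hi => by
      rw [unitAt_mulSingle_of_ne i (fun h => hi (Subtype.ext h)), Units.val_one]
    refine ⟨RestrictedProduct.mulSingle (genLevel L) a.1 g * k, fun i hi => ?_, fun i hi => ?_⟩
    · rw [unitAt_mul, Units.val_mul, norm_mul]
      by_cases hia : i = a
      · subst hia
        rw [hga, hkS' i haS, mul_one]
        exact ((le_max_left _ _).trans hx.le)
      · rw [hgne i hia, norm_one, one_mul]
        exact hkS i ((Finset.mem_insert.1 hi).resolve_left hia)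
    · rw [Finset.mem_insert, not_or] at hi
      rw [unitAt_mul, Units.val_mul, norm_mul, hgne i hi.1, norm_one, one_mul]
      exact hkS' i hi.2

/-- hence every box with finitely many radii `≠ 1` is compact -/
theorem isCompact_setOf_forall_norm_le {S : Set (SplitIdx L)} (hS : S.Finite) (R : SplitIdx L → ℝ)
    (hR : ∀ i ∉ S, R i = 1) : IsCompact {u : Space L | ∀ i, ‖u i‖ ≤ R i} := by
  obtain ⟨k, hkS, hkS'⟩ := exists_model_norm_unitAt hS.toFinset R
  refine (isCompact_smul_box k).of_isClosed_subset ?_ fun u hu => setOf_norm_le_subset_smul_box k fun i => ?_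
  · have h : {u : Space L | ∀ i, ‖u i‖ ≤ R i} = ⋂ i, {u : Space L | ‖u i‖ ≤ R i} := by
      ext u; simp only [Set.mem_setOf_eq, Set.mem_iInter]
    rw [h]
    exact isClosed_iInter fun i =>
      isClosed_le (continuous_norm.comp (RestrictedProduct.continuous_eval i)) continuous_const
  · by_cases hi : i ∈ S
    · exact (hu i).trans (hkS i (hS.mem_toFinset.2 hi))
    · rw [hkS' i (fun h => hi (hS.mem_toFinset.1 h)), ← hR i hi]
      exact hu i

/-! ## §5  Uniform unramifiedness and modulation stabilisers of `𝒮(X)` -/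

section Characters

variable (ψ : ∀ i : SplitIdx L, AddChar ((basePlaceOf L i.1).adicCompletion (maximalRealSubfield L)) Circle)
  (hψc : ∀ i, Continuous (ψ i))
variable (hψO : ∀ᶠ i : SplitIdx L in cofinite,
  ∀ t : (basePlaceOf L i.1).adicCompletion (maximalRealSubfield L), ‖t‖ ≤ 1 → ψ i t = 1)
include hψO

/-- **uniform unramifiedness near `(0, ∏_v 𝒪_v³)`**: there is ONE level `k₀` with `ψ_𝔸(⟨ξ, u⟩) = 1` for
all `ξ ∈ B_{k₀}` and all `u ∈ ∏_v 𝒪_v³` — at the (cofinitely many) unramified places both entries are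
integral, and at each of the finitely many remaining places `ψ_v` is trivial on a ball
(`exists_radius_addChar_eq_one`), which `B_{k₀}` undercuts. -/
theorem exists_level_heisPairing_box_eq_one :
    ∃ k₀, ∀ ξ ∈ levelBall L k₀, ∀ u ∈ (box L : Set (Space L)), heisPairing ψ hψc ξ u = 1 := by
  classical
  have hSf : {i : SplitIdx L | ¬ ∀ t : (basePlaceOf L i.1).adicCompletion (maximalRealSubfield L),
      ‖t‖ ≤ 1 → ψ i t = 1}.Finite := hψO
  have hδ : ∀ i : SplitIdx L, ∃ δ : ℝ, 0 < δ ∧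
      ∀ t : (basePlaceOf L i.1).adicCompletion (maximalRealSubfield L), ‖t‖ ≤ δ → ψ i t = 1 :=
    fun i => exists_radius_addChar_eq_one (ψ i) (hψc i)
  choose δ hδ0 hδ1 using hδ
  have hm : ∀ i : SplitIdx L, ∃ m : ℕ, (1 / 2 : ℝ) ^ m ≤ δ i := fun i => by
    obtain ⟨m, hm⟩ := exists_pow_lt_of_lt_one (hδ0 i) (by norm_num : (1 / 2 : ℝ) < 1)
    exact ⟨m, hm.le⟩
  choose m hm using hm
  refine ⟨hSf.toFinset.sup fun i => max (enumIdx L i + 1) (m i), fun ξ hξ u hu => ?_⟩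
  unfold heisPairing
  refine finprod_eq_one_of_forall_eq_one fun i => ?_
  by_cases hi : ∀ t : (basePlaceOf L i.1).adicCompletion (maximalRealSubfield L), ‖t‖ ≤ 1 → ψ i t = 1
  · exact locFactor_eq_one_of_mem ψ hψc hi (levelBall_subset_box L _ hξ i) ((mem_box_iff L u).1 hu i)
  · have hiT : i ∈ hSf.toFinset := hSf.mem_toFinset.2 hi
    have hle : max (enumIdx L i + 1) (m i) ≤ hSf.toFinset.sup fun i => max (enumIdx L i + 1) (m i) :=
      Finset.le_sup (f := fun i => max (enumIdx L i + 1) (m i)) hiT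
    have hidx : enumIdx L i < hSf.toFinset.sup fun i => max (enumIdx L i + 1) (m i) :=
      lt_of_lt_of_le (Nat.lt_succ_self _) (le_of_max_le_left hle)
    have hmk : m i ≤ hSf.toFinset.sup fun i => max (enumIdx L i + 1) (m i) := le_of_max_le_right hle
    rw [locFactor_apply, addChar_map_finset_sum]
    refine Finset.prod_eq_one fun j _ => hδ1 i _ ?_
    rw [norm_mul]
    have hξj : ‖ξ i j‖ ≤ δ i :=
      calc ‖ξ i j‖ ≤ ‖ξ i‖ := norm_le_pi_norm _ j
        _ ≤ rad L _ i := hξ i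
        _ = (1 / 2 : ℝ) ^ (hSf.toFinset.sup fun i => max (enumIdx L i + 1) (m i)) := rad_of_lt hidx
        _ ≤ (1 / 2 : ℝ) ^ (m i) := pow_le_pow_of_le_one (by norm_num) (by norm_num) hmk
        _ ≤ δ i := hm i
    have huj : ‖u i j‖ ≤ 1 := (norm_le_pi_norm _ j).trans ((mem_cube_iff L i _).1 ((mem_box_iff L u).1 hu i))
    calc ‖ξ i j‖ * ‖u i j‖ ≤ δ i * 1 := mul_le_mul hξj huj (norm_nonneg _) (hδ0 i).le
      _ = δ i := mul_one _

/-- for every COMPACT `C ⊆ X` there is a level `k` with `ψ_𝔸(⟨ξ, u⟩) = 1` for all `ξ ∈ B_k`, `u ∈ C`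
(cover `C` by finitely many cosets `x + ∏𝒪_v³`; on each, `ψ_𝔸(⟨ξ, x + v⟩) = ψ_𝔸(⟨ξ, x⟩) ψ_𝔸(⟨ξ, v⟩)`, the first
factor is a continuous character of `ξ`, hence `1` on a level ball, the second is `1` by uniform
unramifiedness). -/
theorem exists_level_heisPairing_eq_one_on {C : Set (Space L)} (hC : IsCompact C) :
    ∃ k, ∀ ξ ∈ levelBall L k, ∀ u ∈ C, heisPairing ψ hψc ξ u = 1 := by
  classical
  obtain ⟨k₀, hk₀⟩ := exists_level_heisPairing_box_eq_one ψ hψc hψO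
  obtain ⟨t, -, hcover⟩ :=
    hC.elim_nhds_subcover (fun x => ballCoset L x 0) fun x _ => ballCoset_mem_nhds x 0
  have hx : ∀ x : Space L, ∃ k, ∀ ξ ∈ levelBall L k, heisPairing ψ hψc ξ x = 1 := fun x => by
    obtain ⟨k, hk⟩ := exists_levelBall_char_eq_one (heisCharA ψ hψc hψO x) (heisCharA_apply_add ψ hψc hψO x)
    exact ⟨k, fun ξ hξ => by rw [heisPairing_comm]; exact hk ξ hξ⟩
  choose kx hkx using hx
  refine ⟨max k₀ (t.sup kx), fun ξ hξ u hu => ?_⟩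
  obtain ⟨x, hxt, hux⟩ := Set.mem_iUnion₂.1 (hcover hu)
  obtain ⟨v, hv, rfl⟩ := hux
  rw [heisPairing_add_right ψ hψc hψO,
    hkx x ξ (levelBall_antitone L ((Finset.le_sup hxt).trans (le_max_right _ _)) hξ),
    hk₀ ξ (levelBall_antitone L (le_max_left _ _) hξ) v (levelBall_subset_box L 0 hv), one_mul]

/-- `M_ξ 1_A = 1_A` as soon as `ψ_𝔸(⟨ξ, ·⟩) = 1` on `A` -/
theorem modulate_indCO_of_eq_one {A : Set (Space L)} (hA : IsCompact A) (hAo : IsOpen A) {ξ : Space L}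
    (hξ : ∀ u ∈ A, heisPairing ψ hψc ξ u = 1) :
    modulate (μ L) (heisCharA ψ hψc hψO ξ) (indCO L A hA hAo) = indCO L A hA hAo := by
  apply Lp.ext
  have h2 : ⇑(indCO L A hA hAo) =ᵐ[μ L] A.indicator fun _ => (1 : ℂ) := indicatorConstLp_coeFn
  filter_upwards [coeFn_modulate (μ L) (heisCharA ψ hψc hψO ξ) (indCO L A hA hAo), h2] with u h1 h2
  rw [h1, h2]
  by_cases hu : u ∈ A
  · rw [Set.indicator_of_mem hu, heisCharA_apply, hξ u hu, Circle.coe_one, one_mul]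
  · rw [Set.indicator_of_notMem hu, mul_zero]

/-- **modulation stabilisers**: every `f ∈ 𝒮(X)` is fixed by all `M_ξ = M_{ψ_𝔸(⟨ξ,·⟩)}`, `ξ ∈ B_k`, for ONE
level `k` (a Schwartz–Bruhat function has compact support, on which the characters `ψ_𝔸(⟨ξ, ·⟩)`, `ξ`
small, are `1`). -/
theorem exists_level_modulate_eq {f : Lp ℂ 2 (μ L)} (hf : f ∈ schwartzBruhat L) :
    ∃ k, ∀ ξ ∈ levelBall L k, modulate (μ L) (heisCharA ψ hψc hψO ξ) f = f := by
  induction hf using Submodule.span_induction with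
  | mem f hf =>
    obtain ⟨⟨A, hA, hA'⟩, rfl⟩ := hf
    obtain ⟨k, hk⟩ := exists_level_heisPairing_eq_one_on ψ hψc hψO hA
    exact ⟨k, fun ξ hξ => modulate_indCO_of_eq_one ψ hψc hψO hA hA' (hk ξ hξ)⟩
  | zero => exact ⟨0, fun ξ _ => map_zero _⟩
  | add f f' _ _ hf hf' =>
    obtain ⟨k, hk⟩ := hf
    obtain ⟨k', hk'⟩ := hf'
    refine ⟨max k k', fun ξ hξ => ?_⟩
    rw [map_add, hk ξ (levelBall_antitone L (le_max_left _ _) hξ),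
      hk' ξ (levelBall_antitone L (le_max_right _ _) hξ)]
  | smul c f _ hf =>
    obtain ⟨k, hk⟩ := hf
    exact ⟨k, fun ξ hξ => by rw [map_smul, hk ξ hξ]⟩

/-! ## §6  The smooth vectors of the adelic Heisenberg–Schrödinger representation; `𝒮(X) ⊆ L²(X)^∞` -/

/-- **the smooth vectors** of the Schrödinger representation of the adelic Heisenberg group `H(X ⊕ X)` on
`L²(X)`: the vectors fixed by a CONGRUENCE SUBGROUP `B_k × B_k` (`τ_y`, `y ∈ B_k`, and `M_ξ`, `ξ ∈ B_k`) —
the level balls `B_k` being a neighbourhood basis of `0 ∈ X` by compact open subgroups, this is the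
usual notion "fixed by an open compact subgroup" for the totally disconnected group `H(X ⊕ X)`. -/
def heisSmooth : Submodule ℂ (Lp ℂ 2 (μ L)) where
  carrier := {f | ∃ k, (∀ y ∈ levelBall L k, translate (μ L) y f = f) ∧
    ∀ ξ ∈ levelBall L k, modulate (μ L) (heisCharA ψ hψc hψO ξ) f = f}
  zero_mem' := ⟨0, fun y _ => map_zero _, fun ξ _ => map_zero _⟩
  add_mem' := by
    rintro f f' ⟨k, hk, hkM⟩ ⟨k', hk', hkM'⟩
    refine ⟨max k k', fun y hy => ?_, fun ξ hξ => ?_⟩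
    · rw [map_add, hk y (levelBall_antitone L (le_max_left _ _) hy),
        hk' y (levelBall_antitone L (le_max_right _ _) hy)]
    · rw [map_add, hkM ξ (levelBall_antitone L (le_max_left _ _) hξ),
        hkM' ξ (levelBall_antitone L (le_max_right _ _) hξ)]
  smul_mem' := by
    rintro c f ⟨k, hk, hkM⟩
    exact ⟨k, fun y hy => by rw [map_smul, hk y hy], fun ξ hξ => by rw [map_smul, hkM ξ hξ]⟩

/-- (Ported verbatim from the HodgeCMPerL package; no docstring in the source.) -/
theorem mem_heisSmooth_iff {f : Lp ℂ 2 (μ L)} :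
    f ∈ heisSmooth ψ hψc hψO ↔ ∃ k, (∀ y ∈ levelBall L k, translate (μ L) y f = f) ∧
      ∀ ξ ∈ levelBall L k, modulate (μ L) (heisCharA ψ hψc hψO ξ) f = f :=
  Iff.rfl

/-- **`𝒮(X) ⊆ L²(X)^∞`**: every Schwartz–Bruhat vector is a smooth vector of the adelic
Heisenberg–Schrödinger representation. -/
theorem schwartzBruhat_le_heisSmooth : schwartzBruhat L ≤ heisSmooth ψ hψc hψO := by
  intro f hf
  obtain ⟨k, hk⟩ := exists_level_translate_eq hf
  obtain ⟨k', hk'⟩ := exists_level_modulate_eq ψ hψc hψO hf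
  exact ⟨max k k', fun y hy => hk y (levelBall_antitone L (le_max_left _ _) hy),
    fun ξ hξ => hk' ξ (levelBall_antitone L (le_max_right _ _) hξ)⟩

/-- **`𝒮(X)` = the compactly supported smooth vectors** of the adelic Heisenberg–Schrödinger
representation. -/
theorem mem_schwartzBruhat_iff_heisSmooth {f : Lp ℂ 2 (μ L)} :
    f ∈ schwartzBruhat L ↔ f ∈ heisSmooth ψ hψc hψO ∧
      ∃ C : Set (Space L), IsCompact C ∧ ∀ᵐ u ∂(μ L), u ∉ C → f u = 0 := by
  constructor
  · intro hf
    exact ⟨schwartzBruhat_le_heisSmooth ψ hψc hψO hf, (mem_schwartzBruhat_iff_translate.1 hf).2⟩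
  · rintro ⟨⟨k, hk, -⟩, C, hC, hsupp⟩
    exact mem_schwartzBruhat_of_translate_eq hk hC hsupp

end Characters

end Coeff

end HodgeCM.PerL34.PureTensor.SchrodingerModel
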